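import Mathlib
import HarnessLib
import Summits.QuantumFields.YangMills.Theorems.MirrorModularBoostsHypercubicLimitClosureHalvesDefs
import Summits.QuantumFields.YangMills.Theorems.FradkinShenkerFlowFiniteSusceptibilityWeakCouplingMirrorLogConvex

/-!
# Crux `WeakCouplingHypercubicLimit` (stmt-QuantumFields-16120), line `Sketch`, r14: `stub_mirrorOfRPSpectral` (K2) —
# `RPSpectral` read on mirror correlators at short lags

Registered stub K2 of the skeleton `Cruxes/WeakCouplingHypercubicLimit/Lines/Sketch.lean` (§9, reshape r14).

For a local gauge-invariant `P` of time radius `R` (`|t| + 2 ≤ R` on `supp P`) bounded by `B`, write `Pᴿ = P ∘ Θ`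
(`MirrorDominationAxis0.reflSpecies`, `Θ = cfgReflect`) and `D_P(j) = ⟨P · τ_{j e₀} Pᴿ⟩_{β,2S+1} − ⟨P⟩⟨Pᴿ⟩ =
latticeConnectedCorr r.ρ β (2S+1) P.F Pᴿ.F j`.  The slab functional `Y := Pᴿ ∘ τ_{-(R+1)e₀}` (the mirror translated INTO the
slab `[1, 2R+1]` of `RPSpectral`) has
* `Y(lift (Θ₀ U)) = P(τ_{R e₀} lift U)` (`torusLift_timeReflect`: `lift ∘ Θ₀ = τ_{e₀} ∘ Θ ∘ lift`, `cfgReflect_configShift`,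
  `Θ² = 1`), and `Y(τ_{-n e₀} lift U) = Pᴿ(τ_{-(n+R+1)e₀} lift U)`;
* hence, by translation invariance of the torus Wilson state, the `RPSpectral` pair at lag `n` is the first term of
  `D_P(n + 2R + 1)`, and the mean of `Y` is both `⟨Pᴿ⟩` (translation) and `⟨P⟩` (reflection + translation invariance);
* the bracket at `n = 0` is `D_P(2R+1) ≤ 2B²`.
So with `c := 2R + 1`, eventually in `k`, for `S ≥ L_k`, `c ≤ m`, `2(m + c) ≤ S`:
`|D_P(m)| ≤ 2B² e^{−Δ a_k (m − c)} + C B² e^{−Δ a_k S}`.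

Refs: OsterwalderSeiler1978 §2 (reflection positivity / transfer matrix of Wilson's action); everything here is bookkeeping
of translations and the time reflection on the odd torus. [folklore]
-/

noncomputable section

open MeasureTheory ProbabilityTheory Filter Topology
open Literature.MathematicalPhysics.QuantumFieldTheory hiding Site ZdEdge
open Literature.MathematicalPhysics.QuantumLattice
open Literature.MathematicalPhysics.AQFT
open Summit.QuantumFields.YangMills.Cruxes.HypercubicLimit.CouplingResponse
open Summit.QuantumFields.YangMills.Theorems.FiniteSusceptibilityWeakCoupling

namespace Summit.QuantumFields.YangMills.Theorems.WeakCouplingHypercubicLimit.TraceNormColdPressure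

namespace MirrorOfRPSpectral

open MirrorDominationAxis0

variable {G : Type} [Group G] [TopologicalSpace G] [IsTopologicalGroup G] [CompactSpace G]
  [MeasurableSpace G] [BorelSpace G]

/-- Translation invariance of torus Wilson expectations in lifted form: `∫ F(τ_v Ũ) dμ = ∫ F(Ũ) dμ`. [folklore] -/
theorem integral_comp_configShift_torusLift (r : LatticeRep G) (β : ℝ) (L : ℕ) [NeZero L]
    (F : LGConfig 4 G → ℝ) (v : Fin 4 → ℤ) :
    ∫ U, F (configShift v (torusLift L U)) ∂(wilsonMeasure (d := 4) (L := L) r.ρ β) =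
      ∫ U, F (torusLift L U) ∂(wilsonMeasure (d := 4) (L := L) r.ρ β) := by
  -- adapted from `Literature.MathematicalPhysics.QuantumLattice.integral_comp_configShift_torusLift`
  have h := integral_map_equiv (μ := wilsonMeasure (d := 4) (L := L) r.ρ β)
    (torusConfigShift (Literature.Probability.LatticeModels.Torus.proj L v)) (fun U => F (torusLift L U))
  rw [wilsonMeasure_map_torusConfigShift] at h
  simp only [MirrorDominationAxis0.configShift_torusLift]
  exact h.symm

/-- Reflection invariance of torus Wilson expectations: `∫ H(Θ₀ U) dμ = ∫ H(U) dμ` for measurable real `H`. [folklore] -/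
theorem integral_comp_timeReflect (r : LatticeRep G) (β : ℝ) (L : ℕ) [NeZero L]
    {H : GaugeConfig 4 L G → ℝ} (hH : Measurable H) :
    ∫ U, H (GaugeConfig.timeReflect U) ∂(wilsonMeasure (d := 4) (L := L) r.ρ β) =
      ∫ U, H U ∂(wilsonMeasure (d := 4) (L := L) r.ρ β) :=
  RPCauchySchwarz.integral_comp_eq WilsonRP.measurable_timeReflect
    (RPCauchySchwarz.wilsonMeasure_map_timeReflect r.ρ r.continuous β) hH

/-- `|∫ f g − ∫ f · ∫ g'| ≤ 2B²` for `|f|, |g|, |g'| ≤ B` under a probability measure. [folklore] -/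
theorem sub_mul_le_two_sq {Ω : Type*} [MeasurableSpace Ω] {μ : Measure Ω} [IsProbabilityMeasure μ]
    {f g g' : Ω → ℝ} {B : ℝ} (hf : ∀ ω, |f ω| ≤ B) (hg : ∀ ω, |g ω| ≤ B) (hg' : ∀ ω, |g' ω| ≤ B) :
    (∫ ω, f ω * g ω ∂μ) - (∫ ω, f ω ∂μ) * (∫ ω, g' ω ∂μ) ≤ 2 * B ^ 2 := by
  obtain ⟨ω₀⟩ := nonempty_of_isProbabilityMeasure μ
  have hB : 0 ≤ B := (abs_nonneg _).trans (hf ω₀)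
  have h1 : |∫ ω, f ω * g ω ∂μ| ≤ B * B := by
    have := norm_integral_le_of_norm_le_const (μ := μ) (f := fun ω => f ω * g ω) (C := B * B)
      (Eventually.of_forall fun ω => by
        rw [Real.norm_eq_abs, abs_mul]
        exact mul_le_mul (hf ω) (hg ω) (abs_nonneg _) hB)
    simpa [Real.norm_eq_abs] using this
  have h2 : |∫ ω, f ω ∂μ| ≤ B := by
    have := norm_integral_le_of_norm_le_const (μ := μ) (f := f) (C := B)
      (Eventually.of_forall fun ω => by simpa [Real.norm_eq_abs] using hf ω)
    simpa [Real.norm_eq_abs] using this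
  have h3 : |∫ ω, g' ω ∂μ| ≤ B := by
    have := norm_integral_le_of_norm_le_const (μ := μ) (f := g') (C := B)
      (Eventually.of_forall fun ω => by simpa [Real.norm_eq_abs] using hg' ω)
    simpa [Real.norm_eq_abs] using this
  have h4 : |(∫ ω, f ω ∂μ) * (∫ ω, g' ω ∂μ)| ≤ B * B := by
    rw [abs_mul]; exact mul_le_mul h2 h3 (abs_nonneg _) hB
  have := abs_le.1 h1
  have := abs_le.1 h4
  nlinarith

end MirrorOfRPSpectral

open MirrorDominationAxis0 MirrorOfRPSpectral in
/-- `stub_mirrorOfRPSpectral` (K2) — **`RPSpectral` read on mirror correlators at short lags.**  For a local gauge-invariant `P` of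
time radius `R` (`|t| + 2 ≤ R` on `supp P`) bounded by `B`, the slab functional `Y := Pᴿ ∘ τ_{-(R+1)e₀}` (translate of the mirror into
the slab `[1, 2R+1]`) turns the `RPSpectral` pair `⟨Y(lift Θ₀U) · Y(τ_{-n e₀} lift U)⟩ − ⟨Y⟩²` into `D_P(n + 2R + 1)`
(`torusLift_timeReflect`, `cfgReflect_configShift`, translation and reflection invariance of the torus state), its bracket at `n = 0`
is `D_P(2R+1) ≤ 2B²`, so with `c = 2R + 1`, eventually in `k`, for `S ≥ L_k` and all lags `c ≤ m` with `2(m + c) ≤ S`: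
`|D_P(m)| ≤ 2B² e^{−Δ a_k (m − c)} + C B² e^{−Δ a_k S}`. [folklore] -/
theorem stub_mirrorOfRPSpectral :
    ∀ (G : Type) [Group G] [TopologicalSpace G] [IsTopologicalGroup G] [CompactSpace G]
      [MeasurableSpace G] [BorelSpace G] (r : LatticeRep G) (sch : SpeciesScheme (YMSpecies G)) (Δ C : ℝ),
      0 ≤ Δ → 0 ≤ C → RPSpectral r sch Δ C → ∀ (P : YMSpecies G) (R : ℕ) (B : ℝ),
        (∀ e ∈ P.supp, (e.1 0).natAbs + 2 ≤ R) → (∀ V, |P.F V| ≤ B) →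
        ∃ c : ℕ, ∀ᶠ k in atTop, ∀ (S m : ℕ), sch.L k ≤ S → c ≤ m → 2 * (m + c) ≤ S →
          |latticeConnectedCorr r.ρ (sch.β k) (2 * S + 1) P.F (fun V => P.F (cfgReflect V)) m| ≤
            2 * B ^ 2 * Real.exp (-(Δ * sch.a k * ((m : ℝ) - c))) + C * B ^ 2 * Real.exp (-(Δ * sch.a k * S)) := by
  intro G _ _ _ _ _ _ r sch Δ C _hΔ _hC hRP P R B hR hB
  refine ⟨2 * R + 1, ?_⟩
  filter_upwards [hRP] with k hk S m hS hcm hmS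
  obtain ⟨n, rfl⟩ : ∃ n, m = n + (2 * R + 1) := ⟨m - (2 * R + 1), by omega⟩
  haveI : IsProbabilityMeasure (wilsonMeasure (d := 4) (L := 2 * S + 1) r.ρ (sch.β k)) :=
    isProbabilityMeasure_wilsonMeasure _ r.continuous _
  -- the slab functional `Y = Pᴿ ∘ τ_{-(R+1)e₀}`
  obtain ⟨Y, hY⟩ : ∃ Y : LGConfig 4 G → ℝ,
      Y = fun V => (reflSpecies P).F (configShift (-(Pi.single 0 ((R + 1 : ℕ) : ℤ))) V) := ⟨_, rfl⟩
  have hYm : Measurable Y := hY ▸ (reflSpecies P).measurable.comp (configShift _).measurable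
  have hYb : ∀ U, |Y U| ≤ B := fun U => by rw [hY]; exact hB _
  have hYdep : DependsOn Y {e : Literature.MathematicalPhysics.QuantumLattice.ZdEdge 4 |
      1 ≤ e.1 0 ∧ e.1 0 + (if e.2 = 0 then 1 else 0) ≤ ((2 * R + 1 : ℕ) : ℤ)} := by
    rw [hY]
    intro V W hVW
    apply (reflSpecies P).isCylinder
    intro e he
    have hr := MirrorLogConvex.radius_reflSpecies P (k := 1) hR e (Finset.mem_coe.1 he)
    rw [configShift_apply, configShift_apply]
    apply hVW
    simp only [Set.mem_setOf_eq, sub_neg_eq_add, Pi.add_apply, Pi.single_eq_same]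
    push_cast
    split_ifs <;> omega
  have key := hk S (2 * R + 1) n hS (by omega) Y B hYm hYb hYdep
  -- the lifted reflection and the translates of `Y`
  have hv1 : siteReflect (-(Pi.single 0 ((R + 1 : ℕ) : ℤ)) + Pi.single 0 1 : Fin 4 → ℤ) = Pi.single 0 (R : ℤ) := by
    funext i
    by_cases hi : i = 0
    · subst hi; simp [MirrorDominationAxis0.siteReflect_apply]
    · simp [MirrorDominationAxis0.siteReflect_apply, hi]
  have hv2 : ∀ j : ℕ, (-(Pi.single 0 ((R + 1 : ℕ) : ℤ)) + -Pi.single 0 (j : ℤ) : Fin 4 → ℤ) =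
      -Pi.single 0 ((j + (R + 1) : ℕ) : ℤ) := fun j => by
    funext i
    by_cases hi : i = 0
    · subst hi; simp only [Pi.add_apply, Pi.neg_apply, Pi.single_eq_same]; push_cast; ring
    · simp [hi]
  have hv3 : ∀ j : ℕ, (-Pi.single 0 ((j + (2 * R + 1) : ℕ) : ℤ) + Pi.single 0 (R : ℤ) : Fin 4 → ℤ) =
      -Pi.single 0 ((j + (R + 1) : ℕ) : ℤ) := fun j => by
    funext i
    by_cases hi : i = 0
    · subst hi; simp only [Pi.add_apply, Pi.neg_apply, Pi.single_eq_same]; push_cast; ring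
    · simp [hi]
  have F1 : ∀ U : GaugeConfig 4 (2 * S + 1) G, Y (torusLift (2 * S + 1) (GaugeConfig.timeReflect U)) =
      P.F (configShift (Pi.single 0 (R : ℤ)) (torusLift (2 * S + 1) U)) := fun U => by
    simp only [hY]
    rw [MirrorDominationAxis0.torusLift_timeReflect, MirrorDominationAxis0.configShift_configShift]
    show P.F (cfgReflect _) = _
    rw [MirrorDominationAxis0.cfgReflect_configShift, MirrorDominationAxis0.cfgReflect_cfgReflect, hv1]
  have F2 : ∀ (j : ℕ) (U : GaugeConfig 4 (2 * S + 1) G),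
      Y (configShift (-Pi.single 0 (j : ℤ)) (torusLift (2 * S + 1) U)) =
        (reflSpecies P).F (configShift (-Pi.single 0 ((j + (R + 1) : ℕ) : ℤ)) (torusLift (2 * S + 1) U)) := fun j U => by
    simp only [hY]
    rw [MirrorDominationAxis0.configShift_configShift, hv2 j]
  -- the pair at lag `j` is the first term of `D_P(j + 2R + 1)`
  have hpair : ∀ j : ℕ,
      ∫ U, Y (torusLift (2 * S + 1) (GaugeConfig.timeReflect U)) *
          Y (configShift (-Pi.single 0 (j : ℤ)) (torusLift (2 * S + 1) U))
        ∂(wilsonMeasure (d := 4) (L := 2 * S + 1) r.ρ (sch.β k)) =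
      ∫ U, P.F (torusLift (2 * S + 1) U) *
          (reflSpecies P).F (configShift (-Pi.single 0 ((j + (2 * R + 1) : ℕ) : ℤ)) (torusLift (2 * S + 1) U))
        ∂(wilsonMeasure (d := 4) (L := 2 * S + 1) r.ρ (sch.β k)) := fun j => by
    simp_rw [F1, F2]
    have h := integral_comp_configShift_torusLift r (sch.β k) (2 * S + 1)
      (fun V => P.F V * (reflSpecies P).F (configShift (-Pi.single 0 ((j + (2 * R + 1) : ℕ) : ℤ)) V))
      (Pi.single 0 (R : ℤ))
    simp only [MirrorDominationAxis0.configShift_configShift, hv3 j] at h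
    exact h
  -- the mean of `Y` is `⟨Pᴿ⟩` and `⟨P⟩`
  have hmean1 : ∫ U, Y (torusLift (2 * S + 1) U) ∂(wilsonMeasure (d := 4) (L := 2 * S + 1) r.ρ (sch.β k)) =
      ∫ U, (reflSpecies P).F (torusLift (2 * S + 1) U) ∂(wilsonMeasure (d := 4) (L := 2 * S + 1) r.ρ (sch.β k)) := by
    simp only [hY]
    exact integral_comp_configShift_torusLift r (sch.β k) (2 * S + 1) _ _
  have hmean2 : ∫ U, Y (torusLift (2 * S + 1) U) ∂(wilsonMeasure (d := 4) (L := 2 * S + 1) r.ρ (sch.β k)) =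
      ∫ U, P.F (torusLift (2 * S + 1) U) ∂(wilsonMeasure (d := 4) (L := 2 * S + 1) r.ρ (sch.β k)) := by
    refine (integral_comp_timeReflect r (sch.β k) (2 * S + 1) (H := fun U => Y (torusLift (2 * S + 1) U))
      (hYm.comp (measurable_torusLift _))).symm.trans ?_
    simp_rw [F1]
    exact integral_comp_configShift_torusLift r (sch.β k) (2 * S + 1) _ _
  -- identification with the mirror correlator
  have hD : ∀ j : ℕ,
      (∫ U, Y (torusLift (2 * S + 1) (GaugeConfig.timeReflect U)) *
          Y (configShift (-Pi.single 0 (j : ℤ)) (torusLift (2 * S + 1) U))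
        ∂(wilsonMeasure (d := 4) (L := 2 * S + 1) r.ρ (sch.β k))) -
        (∫ U, Y (torusLift (2 * S + 1) U) ∂(wilsonMeasure (d := 4) (L := 2 * S + 1) r.ρ (sch.β k))) ^ 2 =
      latticeConnectedCorr r.ρ (sch.β k) (2 * S + 1) P.F (fun V => P.F (cfgReflect V)) (j + (2 * R + 1)) := fun j => by
    rw [hpair j, sq]
    nth_rewrite 1 [hmean2]
    rw [hmean1]
    rfl
  have hpair0 : (∫ U, Y (torusLift (2 * S + 1) (GaugeConfig.timeReflect U)) * Y (torusLift (2 * S + 1) U)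
        ∂(wilsonMeasure (d := 4) (L := 2 * S + 1) r.ρ (sch.β k))) -
        (∫ U, Y (torusLift (2 * S + 1) U) ∂(wilsonMeasure (d := 4) (L := 2 * S + 1) r.ρ (sch.β k))) ^ 2 =
      latticeConnectedCorr r.ρ (sch.β k) (2 * S + 1) P.F (fun V => P.F (cfgReflect V)) (0 + (2 * R + 1)) := by
    rw [← hD 0]
    simp
  rw [hD n, hpair0] at key
  -- the bracket at lag `2R+1` is at most `2B²`
  have hbr : latticeConnectedCorr r.ρ (sch.β k) (2 * S + 1) P.F (fun V => P.F (cfgReflect V)) (0 + (2 * R + 1)) ≤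
      2 * B ^ 2 :=
    sub_mul_le_two_sq (fun U => hB _) (fun U => hB _) (fun U => hB _)
  have hexp : Real.exp (-(Δ * sch.a k * (((n + (2 * R + 1) : ℕ) : ℝ) - ((2 * R + 1 : ℕ) : ℝ)))) =
      Real.exp (-(Δ * sch.a k * n)) := by
    congr 3; push_cast; ring
  calc |latticeConnectedCorr r.ρ (sch.β k) (2 * S + 1) P.F (fun V => P.F (cfgReflect V)) (n + (2 * R + 1))|
      ≤ Real.exp (-(Δ * sch.a k * n)) *
          latticeConnectedCorr r.ρ (sch.β k) (2 * S + 1) P.F (fun V => P.F (cfgReflect V)) (0 + (2 * R + 1)) +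
        C * B ^ 2 * Real.exp (-(Δ * sch.a k * S)) := key
    _ ≤ Real.exp (-(Δ * sch.a k * n)) * (2 * B ^ 2) + C * B ^ 2 * Real.exp (-(Δ * sch.a k * S)) := by
        gcongr
    _ = 2 * B ^ 2 * Real.exp (-(Δ * sch.a k * (((n + (2 * R + 1) : ℕ) : ℝ) - ((2 * R + 1 : ℕ) : ℝ)))) +
        C * B ^ 2 * Real.exp (-(Δ * sch.a k * S)) := by rw [hexp]; ring

/-- Consistency check: the registered signature of K2 with every tree name written in full. [folklore] -/
example : ∀ (G : Type) [Group G] [TopologicalSpace G] [IsTopologicalGroup G] [CompactSpace G]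
    [MeasurableSpace G] [BorelSpace G] (r : Literature.MathematicalPhysics.QuantumFieldTheory.LatticeRep G)
    (sch : Literature.MathematicalPhysics.QuantumFieldTheory.SpeciesScheme
      (Literature.MathematicalPhysics.QuantumFieldTheory.YMSpecies G)) (Δ C : ℝ),
    0 ≤ Δ → 0 ≤ C → Summit.QuantumFields.YangMills.Cruxes.HypercubicLimit.CouplingResponse.RPSpectral r sch Δ C →
    ∀ (P : Literature.MathematicalPhysics.QuantumFieldTheory.YMSpecies G) (R : ℕ) (B : ℝ),
      (∀ e ∈ P.supp, (e.1 0).natAbs + 2 ≤ R) → (∀ V, |P.F V| ≤ B) →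
      ∃ c : ℕ, ∀ᶠ k in Filter.atTop, ∀ (S m : ℕ), sch.L k ≤ S → c ≤ m → 2 * (m + c) ≤ S →
        |Literature.MathematicalPhysics.QuantumFieldTheory.latticeConnectedCorr r.ρ (sch.β k) (2 * S + 1) P.F
            (fun V => P.F (Literature.MathematicalPhysics.QuantumFieldTheory.cfgReflect V)) m| ≤
          2 * B ^ 2 * Real.exp (-(Δ * sch.a k * ((m : ℝ) - c))) + C * B ^ 2 * Real.exp (-(Δ * sch.a k * S)) :=
  stub_mirrorOfRPSpectral

end Summit.QuantumFields.YangMills.Theorems.WeakCouplingHypercubicLimit.TraceNormColdPressure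

end
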